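import Summits.AtomisticToContinuum.HydrodynamicLimit.Theorems.AntiMazurCoboundariesCorrectorPressureDecayKiferWallMacroErgodic
import Summits.AtomisticToContinuum.HydrodynamicLimit.Theorems.AntiMazurCoboundariesCorrectorPressureDecayKiferCanonicalWindowEntropyFinite
import Summits.AtomisticToContinuum.HydrodynamicLimit.Theorems.AntiMazurCoboundariesCorrectorPressureDecayKiferGibbsDensity
import Summits.AtomisticToContinuum.HydrodynamicLimit.Theorems.AntiMazurCoboundariesCorrectorPressureDecayKiferFreeMeanCount

/-!
# The wall for dense states (line `FirstLemma`, crux stmt-AtomisticToContinuum-14135 `AntiMazurCoboundaries.CorrectorPressureDecay`)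

Registered stub `denseTangentWall_holds : DenseTangentWall` (the dense-state half of the wall decomposition
`localLimitWall_of_macroErgodicity` of `…KiferWallMacroErgodic.lean`), namespace
`Summit.AtomisticToContinuum.HydrodynamicLimit.Theorems.KiferCompactification`: for every density floor `η₀ > 0`,
temperature `θ > 0` and drift `u₀` there is `σd > 0` such that for `0 < σ < σd`, `a > 0`, every canonical local limit
`G ∈ IsCanonicalLocalLimitRef σ a θ u₀`, every translation-invariant probability law `μ` of density `ρ ≥ η₀` and every
continuous `|g| ≤ 1`, `ofReal |E_μ[Σ_{p ∈ ω ∩ [0,1)³×ℝ³} g((p.2 − u₀)/√θ)]| ≤ h(μ | G)`. Proof (no dynamics, no Gibbs property):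

* `ofReal_abs_integral_windowSumReal_le_density` — THE BIAS IS AT MOST THE DENSITY: `|Σ_{p ∈ ω ∩ [0,1)³×ℝ³} F(p)| ≤ N_{[0,1)³}(ω)`
  for `|F| ≤ 1` whenever the count is finite, which it is a.s. when `ρ < ∞` (if `ρ = ∞` there is nothing to prove);
* `ofReal_mul_lintegral_le_klDiv_add` — DONSKER–VARADHAN FOR A NONNEGATIVE UNBOUNDED TEST FUNCTION in `ℝ≥0∞` form:
  `λ E_P[N] ≤ KL(P ‖ Q) + B` as soon as `E_Q[e^{λ min(N, M)}] ≤ e^B` for all truncation levels `M` (the log-form Gibbs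
  inequality `Literature.Probability.Divergences.integral_le_toReal_klDiv_add_log`, then monotone convergence);
* `lintegral_exp_count_dominating_le` — under the explicit Poisson-type majorant `∑ₘ (ξᵐ/m!) · cfg_* (Leb_Λ ⊗ N(u₀,θ))^{⊗m}`
  of the window laws of the blown-up canonical laws (`windowLaw_canonicalBlowUp_le_sum`, `ξ = σ³/(1 − v₁σ³)`) the exponential
  moments of the number of points are at most `exp(ξ · vol Λ · e^λ)`; setwise limits of dominated measures are dominated
  (`windowLaw_le_of_isCanonicalLocalLimit`), so the same bound holds for the window laws of every canonical local limit `G`;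
* `density_mul_volume_centredBox_le_lintegral_count` — by translation invariance `E_μ[N_{Λ_n}] ≥ ρ · vol Λ_n` (the centred
  box `Λ_n` contains the `(2n+2)³` disjoint lattice translates of the unit cube, each of mean `ρ`);
* `density_mul_volume_le_klDiv_windowLaw` — with `λ = 2`: `2ρ vol Λ_n ≤ KL(μ_{Λ_n} ‖ G_{Λ_n}) + ξ e² vol Λ_n`, hence
  `ρ vol Λ_n ≤ KL(μ_{Λ_n} ‖ G_{Λ_n})` once `ξ(σ) e² ≤ ρ`; dividing by the volume and passing to the `limsup`,
  `ρ ≤ h(μ | G)`. Since `ξ(σ) ≤ σ` for `σ ≤ 1/2` (`v₁σ³ ≤ 11/20`), the threshold `σd := min(1/2, min(η₀,1)/e²)` works.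
-/

noncomputable section

open MeasureTheory ProbabilityTheory Set Filter Topology InformationTheory
open scoped ENNReal NNReal

namespace Summit.AtomisticToContinuum.HydrodynamicLimit.Theorems.KiferCompactification

open Literature.MathematicalPhysics.KineticTheory (T3 V3 hsDiameter v₁ v₁_mul_cube_le gaussMeasure)
open Literature.MathematicalPhysics.KineticTheory.PointProcess (windowLaw windowRestrict centredBox density
  specificRelEntropy measurable_windowRestrict isProbabilityMeasure_windowLaw)
open Literature.Analysis.FluidPDE (HardSphereFlow IsTranslationInvariant windowSumReal particlesIn particlesIn_eq
  mem_particlesIn_iff)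
open Literature.Analysis.FunctionSpaces (PointConfig)
open Literature.Analysis.FunctionSpaces.Torus (unitCube measurableSet_unitCube)

/-! ## Donsker–Varadhan with a nonnegative unbounded test function -/

/-- Truncation at natural levels exhausts: `⨆_M min a M = a` in `ℝ≥0∞` (private copy of the elementary fact of
`Literature/Analysis/FunctionSpaces/MixedNormTestDuality.lean`, which is not in the import closure). -/
private theorem iSup_min_natCast (a : ℝ≥0∞) : ⨆ M : ℕ, min a (M : ℝ≥0∞) = a := by
  refine le_antisymm (iSup_le fun M => min_le_left _ _) ?_
  rcases eq_or_ne a ∞ with rfl | ha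
  · rw [show (fun M : ℕ => min (∞ : ℝ≥0∞) (M : ℝ≥0∞)) = fun M : ℕ => (M : ℝ≥0∞) from funext fun M => min_eq_right le_top,
      ENNReal.iSup_natCast]
  · obtain ⟨M, hM⟩ := ENNReal.exists_nat_gt ha
    exact le_iSup_of_le M (by rw [min_eq_left hM.le])

/-- **Donsker–Varadhan for a nonnegative unbounded test function, `ℝ≥0∞` form.** For probability measures `P, Q`, a
measurable `N : α → ℝ≥0∞`, `l ≥ 0` and `B` with `∫⁻ e^{l · min(N, M)} dQ ≤ e^B` for every truncation level `M : ℕ`: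
`l · ∫⁻ N dP ≤ KL(P ‖ Q) + B` (the log-form Gibbs inequality for the bounded measurable `l · min(N, M)`, then `M → ∞` by
monotone convergence; trivial when `KL(P ‖ Q) = ∞`). -/
theorem ofReal_mul_lintegral_le_klDiv_add {α : Type*} [MeasurableSpace α] (P Q : Measure α) [IsProbabilityMeasure P]
    [IsProbabilityMeasure Q] {N : α → ℝ≥0∞} (hN : Measurable N) {l B : ℝ} (hl : 0 ≤ l)
    (hQ : ∀ M : ℕ, ∫⁻ x, ENNReal.ofReal (Real.exp (l * (min (N x) (M : ℝ≥0∞)).toReal)) ∂Q ≤ ENNReal.ofReal (Real.exp B)) :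
    ENNReal.ofReal l * ∫⁻ x, N x ∂P ≤ klDiv P Q + ENNReal.ofReal B := by
  rcases eq_or_ne (klDiv P Q) ∞ with htop | htop
  · rw [htop, top_add]
    exact le_top
  have hmeasM : ∀ M : ℕ, Measurable fun x => min (N x) (M : ℝ≥0∞) := fun M => hN.min measurable_const
  have hmono : Monotone fun (M : ℕ) (x : α) => min (N x) (M : ℝ≥0∞) := fun M M' h x => min_le_min le_rfl (by exact_mod_cast h)
  rw [show (fun x => N x) = fun x => ⨆ M : ℕ, min (N x) (M : ℝ≥0∞) from funext fun x => (iSup_min_natCast (N x)).symm,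
    lintegral_iSup hmeasM hmono, ENNReal.mul_iSup]
  refine iSup_le fun M => ?_
  -- the bounded test function `ψ = l · min(N, M)`
  set ψ : α → ℝ := fun x => l * (min (N x) (M : ℝ≥0∞)).toReal with hψ
  have hminTop : ∀ x, min (N x) (M : ℝ≥0∞) ≠ ∞ := fun x => ne_top_of_le_ne_top (ENNReal.natCast_ne_top M) (min_le_right _ _)
  have hmin_le : ∀ x, (min (N x) (M : ℝ≥0∞)).toReal ≤ M := fun x => by
    have h := ENNReal.toReal_mono (ENNReal.natCast_ne_top M) (min_le_right (N x) (M : ℝ≥0∞))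
    rwa [ENNReal.toReal_natCast] at h
  have hψm : Measurable ψ := measurable_const.mul (hmeasM M).ennreal_toReal
  have hψ0 : ∀ x, 0 ≤ ψ x := fun x => mul_nonneg hl ENNReal.toReal_nonneg
  have hψb : ∀ x, |ψ x| ≤ l * M := fun x => by
    rw [abs_of_nonneg (hψ0 x)]
    exact mul_le_mul_of_nonneg_left (hmin_le x) hl
  have hDV := Literature.Probability.Divergences.integral_le_toReal_klDiv_add_log htop hψm hψb
  -- the exponential moment of `ψ` under `Q`
  have hexpi : Integrable (fun x => Real.exp (ψ x)) Q :=
    Integrable.of_bound hψm.exp.aestronglyMeasurable (Real.exp (l * M)) (ae_of_all _ fun x => by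
      rw [Real.norm_eq_abs, abs_of_pos (Real.exp_pos _)]
      exact Real.exp_le_exp.2 ((le_abs_self _).trans (hψb x)))
  have hZ : ∫ x, Real.exp (ψ x) ∂Q ≤ Real.exp B := by
    rw [integral_eq_lintegral_of_nonneg_ae (ae_of_all _ fun x => (Real.exp_pos _).le) hψm.exp.aestronglyMeasurable]
    exact ENNReal.toReal_le_of_le_ofReal (Real.exp_pos _).le (hQ M)
  have hlog : Real.log (∫ x, Real.exp (ψ x) ∂Q) ≤ B := by
    rw [← Real.log_exp B]
    exact Real.log_le_log (integral_exp_pos hexpi) hZ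
  -- the left-hand side as a Bochner integral
  have hψi : Integrable ψ P :=
    Integrable.of_bound hψm.aestronglyMeasurable (l * M) (ae_of_all _ fun x => by rw [Real.norm_eq_abs]; exact hψb x)
  have hpt : ∀ x, ENNReal.ofReal (ψ x) = ENNReal.ofReal l * min (N x) (M : ℝ≥0∞) := fun x => by
    rw [hψ, ENNReal.ofReal_mul hl, ENNReal.ofReal_toReal (hminTop x)]
  have hlhs : ENNReal.ofReal l * ∫⁻ x, min (N x) (M : ℝ≥0∞) ∂P = ENNReal.ofReal (∫ x, ψ x ∂P) := by
    rw [ofReal_integral_eq_lintegral_ofReal hψi (ae_of_all _ hψ0)]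
    simp_rw [hpt]
    rw [lintegral_const_mul _ (hmeasM M)]
  rw [hlhs]
  calc ENNReal.ofReal (∫ x, ψ x ∂P) ≤ ENNReal.ofReal ((klDiv P Q).toReal + B) := ENNReal.ofReal_le_ofReal (hDV.trans (by linarith))
    _ ≤ ENNReal.ofReal (klDiv P Q).toReal + ENNReal.ofReal B := ENNReal.ofReal_add_le
    _ = klDiv P Q + ENNReal.ofReal B := by rw [ENNReal.ofReal_toReal htop]

/-! ## Exponential moments of the number of points under the Poisson-type majorant -/

/-- A window configuration of `m` labelled points has at most `m` points in any set. -/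
theorem count_windowRestrict_ofFn_le (Λ : Set V3) {m : ℕ} (w : Fin m → V3 × V3) (s : Set (V3 × V3)) :
    (((windowRestrict Λ (PointConfig.ofFn w)).count s : ℕ∞) : ℝ≥0∞) ≤ m := by
  have h1 : (windowRestrict Λ (PointConfig.ofFn w)).count s ≤ (m : ℕ∞) := by
    unfold PointConfig.count
    calc ((windowRestrict Λ (PointConfig.ofFn w)).carrier ∩ s).encard ≤ (Set.range w).encard :=
          Set.encard_le_encard fun p hp => hp.1.1
      _ = (w '' Set.univ).encard := by rw [Set.image_univ]
      _ ≤ (Set.univ : Set (Fin m)).encard := Set.encard_image_le _ _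
      _ = m := by rw [Set.encard_univ, ENat.card_eq_coe_fintype_card, Fintype.card_fin]
  exact_mod_cast h1

/-- **Exponential moments of the number of points under the majorant.** For the Poisson-type majorant
`∑ₘ (ξᵐ/m!) · cfg_* (Leb_Λ ⊗ N(u₀,θ))^{⊗m}` (`ξ ≥ 0`, `vol Λ < ∞`), `l ≥ 0`, any set `s` and truncation level `M`:
`∫⁻ e^{l · min(N_s, M)} ≤ exp(ξ · vol(Λ) · e^l)` — the `m`-th term lives on configurations of at most `m` points and has
mass `ξᵐ vol(Λ)ᵐ/m!`, and `∑ₘ (ξ vol(Λ) e^l)ᵐ/m! = exp(ξ vol(Λ) e^l)`. -/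
theorem lintegral_exp_count_dominating_le {Λ : Set V3} (hΛv : volume Λ ≠ ∞) (u₀ : V3) (θ : ℝ) {ξ l : ℝ}
    (hξ : 0 ≤ ξ) (hl : 0 ≤ l) (s : Set (V3 × V3)) (M : ℕ) :
    ∫⁻ X, ENNReal.ofReal (Real.exp (l * (min ((X.count s : ℕ∞) : ℝ≥0∞) (M : ℝ≥0∞)).toReal))
      ∂(Measure.sum (fun m : ℕ => ENNReal.ofReal (ξ ^ m / m.factorial) •
        (Measure.pi (fun _ : Fin m => ((volume : Measure V3).restrict Λ).prod (gaussMeasure u₀ θ))).map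
          (fun w : Fin m → V3 × V3 => windowRestrict Λ (PointConfig.ofFn w)))) ≤
      ENNReal.ofReal (Real.exp (ξ * (volume Λ).toReal * Real.exp l)) := by
  set V : ℝ := (volume Λ).toReal with hV
  have hV0 : 0 ≤ V := ENNReal.toReal_nonneg
  set ρ₁ : Measure (V3 × V3) := ((volume : Measure V3).restrict Λ).prod (gaussMeasure u₀ θ) with hρ₁
  haveI : SigmaFinite ρ₁ := by rw [hρ₁]; infer_instance
  have hρ₁univ : ρ₁ univ = ENNReal.ofReal V := by
    rw [hρ₁, ← Set.univ_prod_univ, Measure.prod_prod, Measure.restrict_apply_univ, measure_univ, mul_one, hV,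
      ENNReal.ofReal_toReal hΛv]
  set F : PointConfig (V3 × V3) → ℝ≥0∞ := fun X =>
    ENNReal.ofReal (Real.exp (l * (min ((X.count s : ℕ∞) : ℝ≥0∞) (M : ℝ≥0∞)).toReal)) with hF
  rw [lintegral_sum_measure]
  have hterm : ∀ m : ℕ, ∫⁻ X, F X ∂(ENNReal.ofReal (ξ ^ m / m.factorial) • (Measure.pi (fun _ : Fin m => ρ₁)).map
      (fun w : Fin m → V3 × V3 => windowRestrict Λ (PointConfig.ofFn w))) ≤ ENNReal.ofReal ((ξ * V * Real.exp l) ^ m / m.factorial) := by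
    intro m
    rw [lintegral_smul_measure]
    calc ENNReal.ofReal (ξ ^ m / m.factorial) * ∫⁻ X, F X ∂(Measure.pi (fun _ : Fin m => ρ₁)).map
          (fun w : Fin m → V3 × V3 => windowRestrict Λ (PointConfig.ofFn w))
        ≤ ENNReal.ofReal (ξ ^ m / m.factorial) * ∫⁻ w, F (windowRestrict Λ (PointConfig.ofFn w)) ∂(Measure.pi (fun _ : Fin m => ρ₁)) :=
          mul_le_mul' le_rfl (lintegral_map_le _ _)
      _ ≤ ENNReal.ofReal (ξ ^ m / m.factorial) * ∫⁻ _w, ENNReal.ofReal (Real.exp (l * m)) ∂(Measure.pi (fun _ : Fin m => ρ₁)) := by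
          refine mul_le_mul' le_rfl (lintegral_mono fun w => ENNReal.ofReal_le_ofReal (Real.exp_le_exp.2 ?_))
          refine mul_le_mul_of_nonneg_left ?_ hl
          have h2 := ENNReal.toReal_mono (ENNReal.natCast_ne_top m)
            ((min_le_left _ (M : ℝ≥0∞)).trans (count_windowRestrict_ofFn_le Λ w s))
          rwa [ENNReal.toReal_natCast] at h2
      _ = ENNReal.ofReal (ξ ^ m / m.factorial) * (ENNReal.ofReal (Real.exp (l * m)) * ENNReal.ofReal V ^ m) := by
          rw [lintegral_const, Measure.pi_univ]
          simp only [Finset.prod_const, Finset.card_univ, Fintype.card_fin, hρ₁univ]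
      _ = ENNReal.ofReal ((ξ * V * Real.exp l) ^ m / m.factorial) := by
          rw [← ENNReal.ofReal_pow hV0, ← ENNReal.ofReal_mul (Real.exp_pos _).le, ← ENNReal.ofReal_mul (by positivity)]
          congr 1
          rw [show l * (m : ℝ) = m * l by ring, Real.exp_nat_mul]
          ring
  calc ∑' m : ℕ, ∫⁻ X, F X ∂(ENNReal.ofReal (ξ ^ m / m.factorial) • (Measure.pi (fun _ : Fin m => ρ₁)).map
          (fun w : Fin m → V3 × V3 => windowRestrict Λ (PointConfig.ofFn w)))
      ≤ ∑' m : ℕ, ENNReal.ofReal ((ξ * V * Real.exp l) ^ m / m.factorial) := ENNReal.tsum_le_tsum hterm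
    _ = ENNReal.ofReal (∑' m : ℕ, (ξ * V * Real.exp l) ^ m / m.factorial) :=
        (ENNReal.ofReal_tsum_of_nonneg (fun m => by positivity) (Real.summable_pow_div_factorial _)).symm
    _ = ENNReal.ofReal (Real.exp (ξ * V * Real.exp l)) := by
        rw [congr_fun Real.exp_eq_exp_ℝ (ξ * V * Real.exp l), (NormedSpace.expSeries_div_hasSum_exp (ξ * V * Real.exp l)).tsum_eq]

/-! ## Setwise limits of dominated window laws are dominated -/

/-- **Domination passes to local limits.** If the window laws on `Λ_n` of the blown-up canonical laws along `N` are all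
dominated by one measure `ν`, so is the window law on `Λ_n` of their setwise local limit `G`. -/
theorem windowLaw_le_of_isCanonicalLocalLimit {σ a θ : ℝ} {u₀ : V3} {N : ℕ → ℕ}
    {Φ : ∀ k, HardSphereFlow (Literature.Analysis.FluidPDE.Torus.geometry (Fin 3)) (hsDiameter σ (N k)) (N k + 1)}
    {G : Measure (PointConfig (V3 × V3))} (hloc : IsCanonicalLocalLimit σ a θ u₀ N Φ G) (n : ℕ)
    {ν : Measure (PointConfig (V3 × V3))} (hdom : ∀ k, windowLaw (centredBox n) (canonicalBlowUpLaw σ a θ u₀ (N k) (Φ k)) ≤ ν) :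
    windowLaw (centredBox n) G ≤ ν :=
  Measure.le_iff.2 fun A hA => le_of_tendsto' (hloc _ (measurableSet_centredBox_fin3 n) (isBounded_centredBox n) A hA)
    fun k => Measure.le_iff.1 (hdom k) A hA

/-! ## Translation invariance: the centred box carries mean count at least `ρ · vol` -/

/-- **Mean count of the centred box under a translation-invariant law.** `ρ · vol(Λ_n) ≤ E_μ[N_{Λ_n}]`: the box
`Λ_n = [-(n+1), n+1)³` contains the `(2n+2)³` pairwise disjoint lattice translates `k - (n+1) + [0,1)³`,
`k ∈ {0, …, 2n+1}³`, of the unit cube, each of mean count `ρ = density μ` (`lintegral_count_cube_eq_density`), and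
`vol(Λ_n) = (2n+2)³`. -/
theorem density_mul_volume_centredBox_le_lintegral_count {μ : Measure (PointConfig (V3 × V3))}
    (hTI : IsTranslationInvariant μ) (n : ℕ) :
    density μ * volume (centredBox (d := Fin 3) n) ≤ ∫⁻ ω, ((ω.count (centredBox n ×ˢ (univ : Set V3)) : ℕ∞) : ℝ≥0∞) ∂μ := by
  -- the lattice corners and cubes
  set corner : (Fin 3 → Fin (2 * n + 2)) → V3 := fun k => WithLp.toLp 2 fun i => ((k i : ℕ) : ℝ) - ((n : ℝ) + 1) with hcorner
  set cube : (Fin 3 → Fin (2 * n + 2)) → Set V3 := fun k => (fun x : V3 => x - corner k) ⁻¹' unitCube (Fin 3) with hcube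
  have hmem : ∀ k (x : V3), x ∈ cube k ↔ ∀ i, ((k i : ℕ) : ℝ) - ((n : ℝ) + 1) ≤ x i ∧ x i < ((k i : ℕ) : ℝ) - ((n : ℝ) + 1) + 1 := by
    intro k x
    simp only [hcube, hcorner, mem_preimage, Literature.Analysis.FunctionSpaces.Torus.mem_unitCube, mem_Ico, PiLp.sub_apply]
    exact forall_congr' fun i => ⟨fun h => ⟨by linarith [h.1], by linarith [h.2]⟩, fun h => ⟨by linarith [h.1], by linarith [h.2]⟩⟩
  have hcubem : ∀ k, MeasurableSet (cube k ×ˢ (univ : Set V3)) := fun k =>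
    ((measurable_id.sub measurable_const) measurableSet_unitCube).prod MeasurableSet.univ
  have hsub : ∀ k, cube k ×ˢ (univ : Set V3) ⊆ centredBox n ×ˢ (univ : Set V3) := by
    rintro k ⟨x, v⟩ ⟨hx, -⟩
    refine ⟨fun i => ?_, mem_univ _⟩
    obtain ⟨h1, h2⟩ := (hmem k x).1 hx i
    have hk0 : (0 : ℝ) ≤ ((k i : ℕ) : ℝ) := Nat.cast_nonneg _
    have hk1 : ((k i : ℕ) : ℝ) + 1 ≤ 2 * n + 2 := by exact_mod_cast (k i).isLt
    constructor <;> linarith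
  have hdisj : Pairwise (Function.onFun Disjoint fun k => cube k ×ˢ (univ : Set V3)) := by
    intro k k' hkk'
    rw [Function.onFun, Set.disjoint_left]
    rintro ⟨x, v⟩ ⟨hx, -⟩ ⟨hx', -⟩
    refine hkk' (funext fun i => Fin.ext ?_)
    obtain ⟨h1, h2⟩ := (hmem k x).1 hx i
    obtain ⟨h1', h2'⟩ := (hmem k' x).1 hx' i
    by_contra hne
    rcases Nat.lt_or_gt_of_ne hne with hlt | hlt
    · have : ((k i : ℕ) : ℝ) + 1 ≤ ((k' i : ℕ) : ℝ) := by exact_mod_cast hlt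
      linarith
    · have : ((k' i : ℕ) : ℝ) + 1 ≤ ((k i : ℕ) : ℝ) := by exact_mod_cast hlt
      linarith
  -- pointwise: the counts of the cubes add up to at most the count of the box
  have hpt : ∀ ω : PointConfig (V3 × V3), ∑ k : Fin 3 → Fin (2 * n + 2), ((ω.count (cube k ×ˢ (univ : Set V3)) : ℕ∞) : ℝ≥0∞) ≤
      ((ω.count (centredBox n ×ˢ (univ : Set V3)) : ℕ∞) : ℝ≥0∞) := by
    intro ω
    calc ∑ k : Fin 3 → Fin (2 * n + 2), ((ω.count (cube k ×ˢ (univ : Set V3)) : ℕ∞) : ℝ≥0∞)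
        = ∑ k : Fin 3 → Fin (2 * n + 2), ω.toMeasure (cube k ×ˢ (univ : Set V3)) :=
          Finset.sum_congr rfl fun k _ => (PointConfig.toMeasure_apply ω (hcubem k)).symm
      _ = ω.toMeasure (⋃ k, cube k ×ˢ (univ : Set V3)) := by rw [measure_iUnion hdisj hcubem, tsum_fintype]
      _ ≤ ω.toMeasure (centredBox n ×ˢ (univ : Set V3)) := measure_mono (iUnion_subset hsub)
      _ = _ := PointConfig.toMeasure_apply ω ((measurableSet_centredBox_fin3 n).prod MeasurableSet.univ)
  -- integrate
  have hcard : (Fintype.card (Fin 3 → Fin (2 * n + 2)) : ℝ≥0∞) = volume (centredBox (d := Fin 3) n) := by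
    rw [Fintype.card_fun, Fintype.card_fin, Fintype.card_fin, freeMean_volume_centredBox,
      show (2 : ℝ) * ((n : ℝ) + 1) = ((2 * n + 2 : ℕ) : ℝ) by push_cast; ring, ENNReal.ofReal_natCast]
    push_cast
    ring
  calc density μ * volume (centredBox (d := Fin 3) n) = ∑ _k : Fin 3 → Fin (2 * n + 2), density μ := by
        rw [Finset.sum_const, Finset.card_univ, nsmul_eq_mul, hcard, mul_comm]
    _ = ∑ k : Fin 3 → Fin (2 * n + 2), ∫⁻ ω, ((ω.count (cube k ×ˢ (univ : Set V3)) : ℕ∞) : ℝ≥0∞) ∂μ :=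
        Finset.sum_congr rfl fun k _ => (lintegral_count_cube_eq_density hTI (corner k)).symm
    _ = ∫⁻ ω, ∑ k : Fin 3 → Fin (2 * n + 2), ((ω.count (cube k ×ˢ (univ : Set V3)) : ℕ∞) : ℝ≥0∞) ∂μ :=
        (lintegral_finsetSum _ fun k _ => measurable_from_top.comp (PointConfig.measurable_count (hcubem k))).symm
    _ ≤ _ := lintegral_mono hpt

/-! ## The per-box entropy bound -/

/-- **Dense laws pay their density in entropy, box by box.** For `0 < σ ≤ 1/2`, `a, θ > 0`, a canonical local limit
`G` (probability) along some sizes, a translation-invariant probability law `μ` with `ξ(σ) e² ≤ ρ := density μ`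
(`ξ(σ) = σ³/(1 − v₁σ³)`), and every centred box: `ρ · vol(Λ_n) ≤ KL(μ_{Λ_n} ‖ G_{Λ_n})`. Donsker–Varadhan with the
test function `2 N_{Λ_n}` (`ofReal_mul_lintegral_le_klDiv_add`) against the exponential-moment bound
`E_{G}[e^{2 N_{Λ_n}}] ≤ exp(ξ vol(Λ_n) e²)` (domination of the local limit by the Poisson-type majorant), and
`E_μ[N_{Λ_n}] ≥ ρ vol(Λ_n)`: `2ρ vol ≤ KL + ξ e² vol ≤ KL + ρ vol`. -/
theorem density_mul_volume_le_klDiv_windowLaw {σ a θ : ℝ} {u₀ : V3} (hσ : 0 < σ) (hσ2 : σ ≤ 1 / 2) (ha : 0 < a)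
    (hθ : 0 < θ) {N : ℕ → ℕ}
    {Φ : ∀ k, HardSphereFlow (Literature.Analysis.FluidPDE.Torus.geometry (Fin 3)) (hsDiameter σ (N k)) (N k + 1)}
    {G : Measure (PointConfig (V3 × V3))} [IsProbabilityMeasure G] (hloc : IsCanonicalLocalLimit σ a θ u₀ N Φ G)
    {μ : Measure (PointConfig (V3 × V3))} [IsProbabilityMeasure μ] (hμT : IsTranslationInvariant μ)
    (hξρ : ENNReal.ofReal ((1 - v₁ * σ ^ 3)⁻¹ * σ ^ 3 * Real.exp 2) ≤ density μ) (n : ℕ) :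
    density μ * volume (centredBox (d := Fin 3) n) ≤ klDiv (windowLaw (centredBox n) μ) (windowLaw (centredBox n) G) := by
  set Λ : Set V3 := centredBox n with hΛdef
  have hΛ : MeasurableSet Λ := measurableSet_centredBox_fin3 n
  have hΛv : volume Λ ≠ ∞ := (isBounded_centredBox n).measure_lt_top.ne
  set ξ : ℝ := (1 - v₁ * σ ^ 3)⁻¹ * σ ^ 3 with hξdef
  have hξ0 : 0 ≤ ξ := by
    have := v₁_mul_cube_le hσ.le hσ2
    exact mul_nonneg (inv_nonneg.2 (by linarith)) (pow_nonneg hσ.le 3)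
  haveI : IsProbabilityMeasure (windowLaw Λ μ) := isProbabilityMeasure_windowLaw hΛ μ
  haveI : IsProbabilityMeasure (windowLaw Λ G) := isProbabilityMeasure_windowLaw hΛ G
  -- the counting functional on window configurations
  set Nc : PointConfig (V3 × V3) → ℝ≥0∞ := fun X => ((X.count (univ : Set (V3 × V3)) : ℕ∞) : ℝ≥0∞) with hNc
  have hNcm : Measurable Nc := measurable_from_top.comp (PointConfig.measurable_count MeasurableSet.univ)
  -- domination of the local limit, its exponential moments, Donsker–Varadhan
  have hdomG := windowLaw_le_of_isCanonicalLocalLimit hloc n (fun k => windowLaw_canonicalBlowUp_le_sum u₀ hσ hσ2 ha hθ n (N k) (Φ k))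
  have hQexp : ∀ M : ℕ, ∫⁻ X, ENNReal.ofReal (Real.exp (2 * (min (Nc X) (M : ℝ≥0∞)).toReal)) ∂(windowLaw Λ G) ≤
      ENNReal.ofReal (Real.exp (ξ * (volume Λ).toReal * Real.exp 2)) := fun M =>
    (lintegral_mono' hdomG le_rfl).trans (lintegral_exp_count_dominating_le hΛv u₀ θ hξ0 zero_le_two univ M)
  have hDV := ofReal_mul_lintegral_le_klDiv_add (windowLaw Λ μ) (windowLaw Λ G) hNcm zero_le_two hQexp
  -- the mean count of the box under `μ`
  have hcount : density μ * volume Λ ≤ ∫⁻ X, Nc X ∂(windowLaw Λ μ) := by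
    rw [Literature.MathematicalPhysics.KineticTheory.PointProcess.windowLaw, lintegral_map hNcm (measurable_windowRestrict hΛ)]
    refine (density_mul_volume_centredBox_le_lintegral_count hμT n).trans_eq (lintegral_congr fun ω => ?_)
    simp only [hNc, Literature.MathematicalPhysics.KineticTheory.PointProcess.windowRestrict, PointConfig.count_restrict,
      Set.inter_univ, Set.prod_univ, hΛdef]
  -- the error term is at most `ρ · vol`
  have hB : ENNReal.ofReal (ξ * (volume Λ).toReal * Real.exp 2) ≤ density μ * volume Λ := by
    rw [show ξ * (volume Λ).toReal * Real.exp 2 = ξ * Real.exp 2 * (volume Λ).toReal by ring,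
      ENNReal.ofReal_mul (by positivity), ENNReal.ofReal_toReal hΛv]
    exact mul_le_mul' hξρ le_rfl
  -- assembly in `ℝ≥0∞`
  set D : ℝ≥0∞ := density μ * volume Λ with hD
  have h2 : D + D ≤ klDiv (windowLaw Λ μ) (windowLaw Λ G) + ENNReal.ofReal (ξ * (volume Λ).toReal * Real.exp 2) := by
    calc D + D = ENNReal.ofReal 2 * D := by rw [ENNReal.ofReal_ofNat, two_mul]
      _ ≤ ENNReal.ofReal 2 * ∫⁻ X, Nc X ∂(windowLaw Λ μ) := mul_le_mul' le_rfl hcount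
      _ ≤ _ := hDV
  rcases eq_or_ne D ∞ with hDtop | hDtop
  · rw [hDtop, top_add, top_le_iff, ENNReal.add_eq_top] at h2
    rcases h2 with h2 | h2
    · rw [h2]; exact le_top
    · exact absurd h2 ENNReal.ofReal_ne_top
  · exact (ENNReal.add_le_add_iff_right hDtop).1 (h2.trans (add_le_add le_rfl hB))

/-! ## The bias is at most the density -/

/-- **The unit-cube window functional of a function bounded by one has mean at most the density**:
`ofReal |∫ Σ_{p ∈ ω ∩ [0,1)³×ℝ³} F(p) dμ| ≤ density μ` for `|F| ≤ 1` (if the density is finite, a.s. finitely many points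
lie above the cube and the window sum is at most their number; if it is infinite there is nothing to prove; a
non-integrable window functional has integral `0`). -/
theorem ofReal_abs_integral_windowSumReal_le_density (μ : Measure (PointConfig (V3 × V3))) [IsFiniteMeasure μ]
    {F : V3 × V3 → ℝ} (hF : ∀ p, |F p| ≤ 1) :
    ENNReal.ofReal |∫ ω, windowSumReal ω (unitCube (Fin 3)) F ∂μ| ≤ density μ := by
  rcases eq_or_ne (density μ) ∞ with htop | htop
  · rw [htop]; exact le_top
  rw [density_eq_lintegral_count] at htop ⊢
  set cC : PointConfig (V3 × V3) → ℝ≥0∞ := fun ω => ((ω.count (unitCube (Fin 3) ×ˢ (univ : Set V3)) : ℕ∞) : ℝ≥0∞) with hcC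
  have hcCm : Measurable cC := measurable_from_top.comp (PointConfig.measurable_count (measurableSet_unitCube.prod MeasurableSet.univ))
  have hae : ∀ᵐ ω ∂μ, cC ω < ∞ := ae_lt_top hcCm htop
  have hgood : ∀ ω, cC ω < ∞ → (particlesIn ω (unitCube (Fin 3))).Finite := by
    intro ω hω
    simp only [hcC, ENat.toENNReal_lt_top] at hω
    have h : (ω.carrier ∩ unitCube (Fin 3) ×ˢ (univ : Set V3)).encard < ⊤ := hω
    rw [Set.encard_lt_top_iff] at h
    rwa [particlesIn_eq, ← Set.prod_univ]
  have hW_bd : ∀ ω, cC ω < ∞ → |windowSumReal ω (unitCube (Fin 3)) F| ≤ (cC ω).toReal := by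
    intro ω hω
    rw [windowSumReal_eq_sum (hgood ω hω), toReal_count_eq_sum_indicator (hgood ω hω) (fun p hp => hp.1)]
    refine (Finset.abs_sum_le_sum_abs _ _).trans (Finset.sum_le_sum fun p hp => ?_)
    rw [(hgood ω hω).mem_toFinset, mem_particlesIn_iff] at hp
    rw [Set.indicator_of_mem (show p ∈ unitCube (Fin 3) ×ˢ (univ : Set V3) from ⟨hp.2, mem_univ _⟩)]
    exact hF p
  have hcC_int : Integrable (fun ω => (cC ω).toReal) μ := integrable_toReal_of_lintegral_ne_top hcCm.aemeasurable htop
  have h1 : |∫ ω, windowSumReal ω (unitCube (Fin 3)) F ∂μ| ≤ ∫ ω, (cC ω).toReal ∂μ := by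
    rw [← Real.norm_eq_abs]
    exact norm_integral_le_of_norm_le hcC_int (hae.mono fun ω hω => by rw [Real.norm_eq_abs]; exact hW_bd ω hω)
  calc ENNReal.ofReal |∫ ω, windowSumReal ω (unitCube (Fin 3)) F ∂μ| ≤ ENNReal.ofReal ((∫⁻ ω, cC ω ∂μ).toReal) :=
        ENNReal.ofReal_le_ofReal (h1.trans_eq (integral_toReal hcCm.aemeasurable hae))
    _ = ∫⁻ ω, cC ω ∂μ := ENNReal.ofReal_toReal htop

/-! ## The registered stub -/

/-- Registered stub `denseTangentWall_holds` (line `FirstLemma`): **THE WALL FOR DENSE STATES.** For every density floor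
`η₀ > 0`, `θ > 0`, `u₀`, with `σd := min(1/2, min(η₀, 1)/e²)`: for `0 < σ < σd`, `a > 0`, every canonical local limit
`G ∈ IsCanonicalLocalLimitRef σ a θ u₀`, every translation-invariant probability law `μ` of density `ρ ≥ η₀` and every
continuous `|g| ≤ 1`, `ofReal |bias| ≤ ρ ≤ h(μ | G)`: the first inequality is `ofReal_abs_integral_windowSumReal_le_density`,
the second is `density_mul_volume_le_klDiv_windowLaw` (valid since `ξ(σ) e² ≤ σ e² < min(η₀, 1) ≤ ρ`) divided by the volume
of the centred box and passed to the `limsup`. -/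
theorem denseTangentWall_holds : DenseTangentWall := by
  intro η₀ hη₀ θ u₀ hθ
  -- the threshold
  have hmintop : min η₀ 1 ≠ ∞ := ne_top_of_le_ne_top ENNReal.one_ne_top (min_le_right _ _)
  set t : ℝ := (min η₀ 1).toReal with ht
  have ht0 : 0 < t := ENNReal.toReal_pos (lt_min hη₀ one_pos).ne' hmintop
  have htη : ENNReal.ofReal t ≤ η₀ := by
    rw [ht, ENNReal.ofReal_toReal hmintop]
    exact min_le_left _ _
  refine ⟨min (1 / 2) (t / Real.exp 2), lt_min (by norm_num) (by positivity), ?_⟩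
  intro σ a hσ hσd ha G hRef μ hμP hμT hdense g hg hg1
  obtain ⟨hGP, hGT, N', Φ', hN', hloc⟩ := hRef
  have hσ2 : σ ≤ 1 / 2 := (hσd.trans_le (min_le_left _ _)).le
  have hσt : σ * Real.exp 2 ≤ t := by
    have h := hσd.trans_le (min_le_right _ _)
    rw [lt_div_iff₀ (Real.exp_pos 2)] at h
    exact h.le
  -- `ξ(σ) e² ≤ σ e² ≤ t ≤ η₀ ≤ ρ`
  have hv := v₁_mul_cube_le hσ.le hσ2
  have hcpos : 0 < 1 - v₁ * σ ^ 3 := by linarith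
  have hσsq : σ ^ 2 ≤ 1 / 4 := by nlinarith
  have hξσ : (1 - v₁ * σ ^ 3)⁻¹ * σ ^ 3 ≤ σ := by
    rw [inv_mul_le_iff₀ hcpos]
    nlinarith
  have hξρ : ENNReal.ofReal ((1 - v₁ * σ ^ 3)⁻¹ * σ ^ 3 * Real.exp 2) ≤ density μ :=
    (ENNReal.ofReal_le_ofReal ((mul_le_mul_of_nonneg_right hξσ (Real.exp_pos 2).le).trans hσt)).trans (htη.trans hdense)
  -- `ofReal |bias| ≤ ρ`
  refine (ofReal_abs_integral_windowSumReal_le_density μ (F := fun p => g ((Real.sqrt θ)⁻¹ • (p.2 - u₀)))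
    (fun p => hg1 _)).trans ?_
  -- `ρ ≤ h(μ | G)`
  haveI := hGP
  change density μ ≤ limsup (fun n : ℕ => klDiv (windowLaw (centredBox n) μ) (windowLaw (centredBox n) G) /
    volume (centredBox (d := Fin 3) n)) atTop
  refine le_limsup_of_frequently_le' (Frequently.of_forall fun n => ?_)
  have hV0 : volume (centredBox (d := Fin 3) n) ≠ 0 := by
    rw [freeMean_volume_centredBox]
    exact pow_ne_zero _ (ENNReal.ofReal_pos.2 (by positivity)).ne'
  rw [ENNReal.le_div_iff_mul_le (Or.inl hV0) (Or.inl (isBounded_centredBox n).measure_lt_top.ne)]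
  exact density_mul_volume_le_klDiv_windowLaw hσ hσ2 ha hθ hloc hμT hξρ n

end Summit.AtomisticToContinuum.HydrodynamicLimit.Theorems.KiferCompactification

end
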